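import Summits.KontsevichZagierPeriods.KontsevichZagierPeriods.Theorems.LiouvilleUnfoldingLogPrimitiveNLStructureLineRestrict
import Summits.KontsevichZagierPeriods.KontsevichZagierPeriods.Theorems.LiouvilleUnfoldingLogPrimitiveNLStructureTaylorTransport
import Summits.KontsevichZagierPeriods.KontsevichZagierPeriods.Theorems.LiouvilleUnfoldingLogPrimitiveNLStructureFormal
import HarnessLib

/-!
# `LogPrimitiveNL` (stmt-KontsevichZagierPeriods-2836), line `ax-schanuel-germs`, stub `stub_structure` —
part D: the engine at a point (one real variable)

Given one-variable data on `(-ε, ε)` — `ηᵢ, wᵢ, γ` smooth and `ℝ`-semialgebraic, `wᵢ > 0`, the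
log-derivatives `wᵢ'/wᵢ` `ℝ`-semialgebraic, `Σ ηᵢ log wᵢ = γ` — and the four one-variable engine
stubs of the line as HYPOTHESES (Taylor morphism, polynomial identity + flatness, Rosenlicht
property, abstract log-linear rigidity), every integer vector orthogonal to the local lattice
`{f | (Σ fᵢ log wᵢ)' = 0 near 0}` annihilates the coefficient vector at `0` (`engine_point`): Taylor
transport into `ℝ⸨X⸩`, the abstract theorem over the subfield of algebraic elements, and flatness to
read the abstract lattice as the local one. [folklore assembly of the line's stubs]
-/

noncomputable section

open Set Filter MvPolynomial MeasureTheory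
open scoped ContDiff Topology LaurentSeries RatFunc Polynomial
open Literature.NumberTheory.Transcendental Literature.ModelTheory.ExponentialFields

namespace Summit.KontsevichZagierPeriods.LiouvilleUnfolding.LogPrimitiveNL.AxSchanuelGerms

-- canonical `ℤ`-algebra structure on `ℝ⸨X⸩` (see part C)
attribute [local instance 10000] Ring.toIntAlgebra

/-! ### Part D: the engine at a point (one real variable) -/

section Engine

/-- Smoothness on `(-ε, ε)` gives a germ smooth near `0`. [folklore] -/
theorem smoothNear_of_Ioo {f : ℝ → ℝ} {ε : ℝ} (hε : 0 < ε) (hf : ContDiffOn ℝ ∞ f (Ioo (-ε) ε)) :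
    ∃ U ∈ 𝓝 (0 : ℝ), ContDiffOn ℝ ∞ f U :=
  ⟨Ioo (-ε) ε, Ioo_mem_nhds (by linarith) hε, hf⟩

/-- The derivative of `Σ fᵢ log wᵢ` on the interval is the log-derivative combination
`Σ fᵢ wᵢ'/wᵢ`. [folklore] -/
theorem deriv_sum_mul_log {k : ℕ} (w : Fin k → ℝ → ℝ) {ε : ℝ} (hwc : ∀ i, ContDiffOn ℝ ∞ (w i) (Ioo (-ε) ε))
    (hwpos : ∀ i, ∀ t ∈ Ioo (-ε) ε, 0 < w i t) (f : Fin k → ℤ) {t : ℝ} (ht : t ∈ Ioo (-ε) ε) :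
    deriv (fun s => ∑ i, (f i : ℝ) * Real.log (w i s)) t =
      ∑ i, (f i : ℝ) * (deriv (w i) t / w i t) := by
  have hd : ∀ i, HasDerivAt (w i) (deriv (w i) t) t := fun i =>
    (((hwc i).differentiableOn (by simp)).differentiableAt (Ioo_mem_nhds ht.1 ht.2)).hasDerivAt
  have h : HasDerivAt (fun s => ∑ i, (f i : ℝ) * Real.log (w i s))
      (∑ i, (f i : ℝ) * (deriv (w i) t / w i t)) t := by
    have := HasDerivAt.fun_sum (u := Finset.univ) (A := fun i s => (f i : ℝ) * Real.log (w i s))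
      (A' := fun i => (f i : ℝ) * (deriv (w i) t / w i t)) (x := t)
      (fun i _ => ((hd i).log (hwpos i t ht).ne').const_mul (f i : ℝ))
    simpa using this
  exact h.deriv

/-- **The engine at a point.** One-variable data on `(-ε, ε)`: `ηᵢ, wᵢ, γ` smooth and
`ℝ`-semialgebraic, `wᵢ > 0`, with the log-derivatives `wᵢ'/wᵢ` `ℝ`-semialgebraic, and the
identity `Σ ηᵢ log wᵢ = γ`. Then, given the Taylor morphism, the one-variable toolkit, the
Rosenlicht property and the abstract log-linear theorem (all as hypotheses, in their registered
forms), every integer vector `p` orthogonal to the local lattice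
`{f ∈ ℤᵏ | (Σ fᵢ log wᵢ)' = 0 near 0}` annihilates the coefficient vector at `0`: `Σ pᵢ ηᵢ(0) = 0`.
[folklore] -/
theorem engine_point
    (hT : ∃ T : (ℝ → ℝ) → ℝ⸨X⸩,
      (∀ f g : ℝ → ℝ, f =ᶠ[𝓝 0] g → T f = T g) ∧
      (∀ f g : ℝ → ℝ, (∃ U ∈ 𝓝 (0 : ℝ), ContDiffOn ℝ ∞ f U) →
        (∃ U ∈ 𝓝 (0 : ℝ), ContDiffOn ℝ ∞ g U) →
          T (f + g) = T f + T g ∧ T (f * g) = T f * T g) ∧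
      (∀ f : ℝ → ℝ, (∃ U ∈ 𝓝 (0 : ℝ), ContDiffOn ℝ ∞ f U) →
        T (deriv f) = LaurentSeries.derivative ℝ (T f)) ∧
      (∀ c : ℝ, T (fun _ => c) = HahnSeries.C c) ∧
      T (fun t => t) = HahnSeries.single 1 1 ∧
      (∀ f : ℝ → ℝ, ∃ p : PowerSeries ℝ, T f = HahnSeries.ofPowerSeries ℤ ℝ p) ∧
      (∀ f : ℝ → ℝ, (T f).coeff 0 = f 0) ∧
      (∀ f : ℝ → ℝ, (∃ U ∈ 𝓝 (0 : ℝ), ContDiffOn ℝ ∞ f U) →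
        (T f = 0 ↔ ∀ n : ℕ, iteratedDeriv n f 0 = 0)))
    (hpoly : ∀ (φ : ℝ → ℝ) (a b : ℝ), a < b →
      IsSemialgebraicFunOn ℝ {x : Fin 1 → ℝ | x 0 ∈ Ioo a b} (fun x => φ (x 0)) →
        ∃ q : MvPolynomial (Fin 2) ℝ, q ≠ 0 ∧
          ∀ t ∈ Ioo a b, MvPolynomial.eval (Fin.cons (φ t) fun _ => t) q = 0)
    (hflat : ∀ (φ : ℝ → ℝ) (ε : ℝ), 0 < ε →
      IsSemialgebraicFunOn ℝ {x : Fin 1 → ℝ | x 0 ∈ Ioo (-ε) ε} (fun x => φ (x 0)) →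
        ContDiffOn ℝ ∞ φ (Ioo (-ε) ε) → (∀ n : ℕ, iteratedDeriv n φ 0 = 0) →
          ∀ᶠ t in 𝓝 (0 : ℝ), φ t = 0)
    (hstab : ∀ x : ℝ⸨X⸩, IsAlgebraic (RatFunc ℝ) x →
      IsAlgebraic (RatFunc ℝ) (LaurentSeries.derivative ℝ x))
    (hRP : ∀ (m : ℕ) (e : Fin m → ℝ) (u : Fin m → ℝ⸨X⸩) (v : ℝ⸨X⸩), LinearIndependent ℚ e →
      (∀ j, IsAlgebraic (RatFunc ℝ) (u j)) → (∀ j, u j ≠ 0) → IsAlgebraic (RatFunc ℝ) v →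
      (∑ j, HahnSeries.C (e j) * ((u j)⁻¹ * LaurentSeries.derivative ℝ (u j))) +
          LaurentSeries.derivative ℝ v = 0 →
        ∀ j, LaurentSeries.derivative ℝ (u j) = 0)
    (habs : ∀ (L : Type) [Field L] [CharZero L] (D : Derivation ℤ L L) (F : Subfield L),
      (∀ x ∈ F, D x ∈ F) → (∀ x, D x = 0 → x ∈ F) →
      (∀ (m : ℕ) (c u : Fin m → L) (v : L), (∀ j, D (c j) = 0) → LinearIndependent ℚ c →
        (∀ j, u j ∈ F) → (∀ j, u j ≠ 0) → v ∈ F →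
        (∑ j, c j * ((u j)⁻¹ * D (u j))) + D v = 0 → ∀ j, D (u j) = 0) →
      ∀ (k : ℕ) (η w y : Fin k → L) (g : L), (∀ i, η i ∈ F) → (∀ i, w i ∈ F) →
        (∀ i, w i ≠ 0) → (∀ i, D (y i) = (w i)⁻¹ * D (w i)) → g ∈ F →
        ∑ i, η i * y i = g →
        ∀ p : Fin k → ℤ,
          (∀ f : Fin k → ℤ, D (∑ i, (f i : L) * y i) = 0 → ∑ i, p i * f i = 0) →
          ∑ i, (p i : L) * η i = 0)
    {k : ℕ} (η w : Fin k → ℝ → ℝ) (γ : ℝ → ℝ) {ε : ℝ} (hε : 0 < ε)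
    (hηs : ∀ i, IsSemialgebraicFunOn ℝ {x : Fin 1 → ℝ | x 0 ∈ Ioo (-ε) ε} (fun x => η i (x 0)))
    (hws : ∀ i, IsSemialgebraicFunOn ℝ {x : Fin 1 → ℝ | x 0 ∈ Ioo (-ε) ε} (fun x => w i (x 0)))
    (hγs : IsSemialgebraicFunOn ℝ {x : Fin 1 → ℝ | x 0 ∈ Ioo (-ε) ε} (fun x => γ (x 0)))
    (hlds : ∀ i, IsSemialgebraicFunOn ℝ {x : Fin 1 → ℝ | x 0 ∈ Ioo (-ε) ε}
      (fun x => deriv (w i) (x 0) / w i (x 0)))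
    (hηc : ∀ i, ContDiffOn ℝ ∞ (η i) (Ioo (-ε) ε)) (hwc : ∀ i, ContDiffOn ℝ ∞ (w i) (Ioo (-ε) ε))
    (hγc : ContDiffOn ℝ ∞ γ (Ioo (-ε) ε)) (hwpos : ∀ i, ∀ t ∈ Ioo (-ε) ε, 0 < w i t)
    (hrel : ∀ t ∈ Ioo (-ε) ε, ∑ i, η i t * Real.log (w i t) = γ t)
    (p : Fin k → ℤ)
    (hp : ∀ f : Fin k → ℤ,
      (∀ᶠ t in 𝓝 (0 : ℝ), deriv (fun s => ∑ i, (f i : ℝ) * Real.log (w i s)) t = 0) →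
        ∑ i, p i * f i = 0) :
    ∑ i, (p i : ℝ) * η i 0 = 0 := by
  classical
  obtain ⟨T, hloc, hT2, hder, hC, hX, -, hcoeff, hker⟩ := hT
  haveI : CharZero ℝ⸨X⸩ := charZero_laurentSeries
  obtain ⟨D, hD⟩ := exists_intDerivation_eq_derivative
  set F : Subfield ℝ⸨X⸩ := (algebraicClosure (RatFunc ℝ) ℝ⸨X⸩).toSubfield with hF
  have hI : Ioo (-ε) ε ∈ 𝓝 (0 : ℝ) := Ioo_mem_nhds (by linarith) hε
  -- smooth germs
  have hηn : ∀ i, ∃ U ∈ 𝓝 (0 : ℝ), ContDiffOn ℝ ∞ (η i) U := fun i => smoothNear_of_Ioo hε (hηc i)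
  have hwn : ∀ i, ∃ U ∈ 𝓝 (0 : ℝ), ContDiffOn ℝ ∞ (w i) U := fun i => smoothNear_of_Ioo hε (hwc i)
  have hγn : ∃ U ∈ 𝓝 (0 : ℝ), ContDiffOn ℝ ∞ γ U := smoothNear_of_Ioo hε hγc
  have hwpos' : ∀ i, ∀ᶠ t in 𝓝 (0 : ℝ), 0 < w i t := fun i =>
    Filter.eventually_of_mem hI fun t ht => hwpos i t ht
  have hw0 : ∀ i, ∀ᶠ t in 𝓝 (0 : ℝ), w i t ≠ 0 := fun i => (hwpos' i).mono fun t ht => ht.ne'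
  -- algebraicity over `ℝ(X)` from polynomial identities
  have halg : ∀ φ : ℝ → ℝ, (∃ U ∈ 𝓝 (0 : ℝ), ContDiffOn ℝ ∞ φ U) →
      IsSemialgebraicFunOn ℝ {x : Fin 1 → ℝ | x 0 ∈ Ioo (-ε) ε} (fun x => φ (x 0)) →
      T φ ∈ F := by
    intro φ hφ hφs
    obtain ⟨q, hq0, hq⟩ := hpoly φ (-ε) ε (by linarith) hφs
    rw [hF, mem_algebraicSubfield_iff]
    exact taylor_isAlgebraic T hloc hT2 hC hX hφ hq0
      (Filter.eventually_of_mem hI fun t ht => hq t ht)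
  have hηF : ∀ i, T (η i) ∈ F := fun i => halg _ (hηn i) (hηs i)
  have hwF : ∀ i, T (w i) ∈ F := fun i => halg _ (hwn i) (hws i)
  have hγF : T γ ∈ F := halg _ hγn hγs
  have hwne : ∀ i, T (w i) ≠ 0 := fun i => (taylor_inv T hloc hT2 hC (hwn i) (hw0 i)).1
  -- the logarithms and their derivatives
  set y : Fin k → ℝ⸨X⸩ := fun i => T (fun t => Real.log (w i t)) with hy
  have hDy : ∀ i, D (y i) = (T (w i))⁻¹ * D (T (w i)) := fun i => by
    rw [hD, hD]
    exact derivative_taylor_log T hloc hT2 hder hC (hwn i) (hwpos' i)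
  -- the relation
  have hlogn : ∀ i, ∃ U ∈ 𝓝 (0 : ℝ), ContDiffOn ℝ ∞ (fun t => Real.log (w i t)) U := fun i =>
    smoothNear_log (hwn i) (hwpos' i)
  have hrelT : ∑ i, T (η i) * y i = T γ := by
    have hprodn : ∀ i, ∃ U ∈ 𝓝 (0 : ℝ), ContDiffOn ℝ ∞ (fun s => η i s * Real.log (w i s)) U :=
      fun i => smoothNear_mul (hηn i) (hlogn i)
    have h1 : T (fun t => ∑ i, η i t * Real.log (w i t)) = ∑ i, T (η i) * y i := by
      rw [taylor_sum T hT2 hC Finset.univ (f := fun i s => η i s * Real.log (w i s))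
        fun i _ => hprodn i]
      refine Finset.sum_congr rfl fun i _ => ?_
      exact taylor_mul T hT2 (f := η i) (g := fun t => Real.log (w i t)) (hηn i) (hlogn i)
    rw [← h1]
    exact hloc _ _ (Filter.eventually_of_mem hI fun t ht => hrel t ht)
  -- the abstract theorem
  have key := habs ℝ⸨X⸩ D F (derivation_mem_algebraicSubfield hstab D hD)
    (mem_algebraicSubfield_of_derivation_eq_zero D hD)
    (rosenlicht_abstract_of_real hRP D hD) k (fun i => T (η i)) (fun i => T (w i)) y (T γ)
    hηF hwF hwne hDy hγF hrelT p ?_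
  · -- read off the constant coefficient
    have hsum : T (fun t => ∑ i, (p i : ℝ) * η i t) = ∑ i, (p i : ℝ⸨X⸩) * T (η i) := by
      rw [taylor_linearCombination T hT2 hC (fun i => (p i : ℝ)) hηn]
      refine Finset.sum_congr rfl fun i _ => ?_
      rw [show (HahnSeries.C (p i : ℝ) : ℝ⸨X⸩) = (p i : ℝ⸨X⸩) from map_intCast HahnSeries.C (p i)]
    have h0 : (T (fun t => ∑ i, (p i : ℝ) * η i t)).coeff 0 = 0 := by rw [hsum, key]; rfl
    rw [hcoeff] at h0
    exact h0
  · -- the abstract lattice condition gives a flat, hence locally vanishing, log-derivative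
    intro f hf
    apply hp f
    -- the log-derivative combination `ψ = Σ fᵢ wᵢ'/wᵢ`
    set ψ : ℝ → ℝ := fun t => ∑ i, (f i : ℝ) * (deriv (w i) t * (w i t)⁻¹) with hψ
    have hqn : ∀ i, ∃ U ∈ 𝓝 (0 : ℝ), ContDiffOn ℝ ∞ (fun t => deriv (w i) t * (w i t)⁻¹) U :=
      fun i => smoothNear_mul (smoothNear_deriv (hwn i)) (smoothNear_inv (hwn i) (hw0 i))
    have hψc : ContDiffOn ℝ ∞ ψ (Ioo (-ε) ε) := by
      refine ContDiffOn.sum fun i _ => ContDiffOn.mul contDiffOn_const ?_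
      exact ((hwc i).deriv_of_isOpen isOpen_Ioo (by simp)).mul
        ((hwc i).inv fun t ht => (hwpos i t ht).ne')
    have hψn : ∃ U ∈ 𝓝 (0 : ℝ), ContDiffOn ℝ ∞ ψ U := ⟨Ioo (-ε) ε, hI, hψc⟩
    have hlds' : ∀ i, IsSemialgebraicFunOn ℝ {x : Fin 1 → ℝ | x 0 ∈ Ioo (-ε) ε}
        (fun x => deriv (w i) (x 0) * (w i (x 0))⁻¹) := fun i =>
      (hlds i).congr fun x _ => by simp only [div_eq_mul_inv]
    have hψs : IsSemialgebraicFunOn ℝ {x : Fin 1 → ℝ | x 0 ∈ Ioo (-ε) ε} (fun x => ψ (x 0)) :=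
      isSemialgebraicFunOn_real_linearCombination (isSemialgebraic_setOf_apply_mem_Ioo _ _)
        (fun i => (f i : ℝ)) hlds'
    -- `T ψ = D (Σ fᵢ yᵢ) = 0`
    have hTq : ∀ i, T (fun t => deriv (w i) t * (w i t)⁻¹) = (T (w i))⁻¹ * D (T (w i)) := by
      intro i
      rw [taylor_mul T hT2 (f := deriv (w i)) (g := fun s => (w i s)⁻¹) (smoothNear_deriv (hwn i))
        (smoothNear_inv (hwn i) (hw0 i)), hder _ (hwn i), (taylor_inv T hloc hT2 hC (hwn i) (hw0 i)).2,
        hD, mul_comm]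
    have hTψ : T ψ = D (∑ i, (f i : ℝ⸨X⸩) * y i) := by
      rw [map_sum, hψ, taylor_linearCombination T hT2 hC (fun i => (f i : ℝ))
        (f := fun i t => deriv (w i) t * (w i t)⁻¹) hqn]
      refine Finset.sum_congr rfl fun i _ => ?_
      rw [Derivation.leibniz, show ((f i : ℤ) : ℝ⸨X⸩) = algebraMap ℤ ℝ⸨X⸩ (f i) from
        (eq_intCast _ _).symm, Derivation.map_algebraMap, smul_zero, add_zero, smul_eq_mul,
        eq_intCast, hDy i, hTq i, map_intCast]
    have hT0 : T ψ = 0 := by rw [hTψ, hf]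
    have hflatψ : ∀ n : ℕ, iteratedDeriv n ψ 0 = 0 := (hker ψ hψn).1 hT0
    have hψ0 : ∀ᶠ t in 𝓝 (0 : ℝ), ψ t = 0 := hflat ψ ε hε hψs hψc hflatψ
    filter_upwards [hψ0, hI] with t ht htI
    rw [deriv_sum_mul_log w hwc hwpos f htI]
    simp only [div_eq_mul_inv]
    exact ht

end Engine

/-- **Registered ∀-form** (helper of `stub_structure`, line `ax-schanuel-germs`): smoothness on a
symmetric interval gives a germ smooth near `0` (`smoothNear_of_Ioo`). [folklore] -/
theorem structure_enginePoint_smoothNear : ∀ (f : ℝ → ℝ) (ε : ℝ), 0 < ε →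
    ContDiffOn ℝ ∞ f (Ioo (-ε) ε) → ∃ U ∈ 𝓝 (0 : ℝ), ContDiffOn ℝ ∞ f U :=
  fun _ _ hε hf => smoothNear_of_Ioo hε hf

end Summit.KontsevichZagierPeriods.LiouvilleUnfolding.LogPrimitiveNL.AxSchanuelGerms

end
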